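import Literature.NumberTheory.EllipticCurves.Wuthrich2014.ReducibleDivisibility
import HarnessLib

/-!
# Wuthrich 2014, Corollary 19 — Kato's divisibility at an odd SPLIT MULTIPLICATIVE prime of a semi-stable curve (named fact)

Topic `Literature/NumberTheory/EllipticCurves` (cluster `Wuthrich2014`). ONE named fact (nothing
asserted) and one bookkeeping projection; no other content. HONEST FRAMING (BSD rank-≤1 residual
cell `b2b-bsdres`, unit `b2b-bsdres-x11a` gen 4): the cell deletes the COMBINATION-SHAPED residual
classes of the rank-`≤ 1` BSD formula STRICTLY from published theorems and TYPES the remainder; this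
file supplies one PUBLISHED input of the per-curve `p`-adic certificate lever at a prime `p ‖ N`
(`Rank1Residual/Typed/PAdicCertificateEngine.lean`, p179575) — the divisibility half — for
SEMI-STABLE curves at a SPLIT multiplicative prime; it is not a class theorem and nothing here is
"finishing BSD".

C. Wuthrich, *On the integrality of modular symbols and Kato's Euler system for elliptic curves*,
Doc. Math. 19 (2014) 381–402, doi:10.4171/dm/450 (publisher PDF read 2026-08-19: EMS Press, open
access; the hub's older rendering `paper:doi-10-4171-dm-450` is the author's 2013 version),
Corollary 19 (journal p. 398), as PUBLISHED: "If `E/ℚ` is a semi-stable elliptic curve and `p` an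
odd prime where `E` has ordinary reduction, then `char_Λ(X(E))`, or `I char_Λ(X(E))` in the split
multiplicative case, divides the ideal generated by `L_p(E)`." (The words "where `E` has ordinary
reduction" were added in the published revision of February 17, 2014; a multiplicative prime is
ordinary in the paper's sense, p. 383: "ordinary in the sense that `E` has either good ordinary or
multiplicative reduction".)
Proof as printed (p. 399): "By a Theorem of Serre … the image of `ρ̄_p : G_ℚ → Aut(E[p])` is either
the whole of `GL₂(𝔽_p)` or it is contained in a Borel subgroup. In the latter case the
representation `ρ̄_p` is reducible [and Thm. 16 applies] and in the first case the representation
`ρ_p : G_ℚ → Aut(T_p E)` is surjective by another result of Serre unless `p = 3`" [Kato's theorem in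
the surjective case, §1 p. 383: "This theorem was proven by Kato in [10] in the case that the
reduction is ordinary and the representation on the Tate module was surjective"; `p = 3` by the
lemma following Cor. 19, Lemma 20 (p. 399)]; and "Unfortunately, the hypothesis in Corollary 19
that `E` is semi-stable can not be dropped" (exotic images, p. 399). Notation of §5 (p. 397):
`X(E)` is the Pontryagin dual of the Selmer group of `E`
over the cyclotomic `ℤ_p`-extension (the classical Selmer group: "the elements … that are locally in
the image of the points"; tree `SelmerDualData`), `I` "is the kernel of the homomorphism `Λ → ℤ_p`
that sends all elements of" `Γ` to `1` — the augmentation ideal `(T)`, `T = γ - 1` —, and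
`L_p(E) ∈ Λ` (Cor. 18, p. 398: "The analytic `p`-adic `L`-function `L_p(E)` belongs to `Λ` for all
elliptic curves `E/ℚ` with semi-stable ordinary reduction at `p > 2`") is the `p`-adic
`L`-function of Mazur–Tate–Teitelbaum normalised by the Néron lattice of `E`; at a split
multiplicative `p` this is the function of MTT §I.10 with allowable root `α = a_p = 1` — the tree's
`IsSplitMultPAdicLFunctionOf f p L` (`PAdicBSD.lean`, normalised by `Ω⁺_f` through `[·]⁺_f`),
converted by a period ratio `ϖ` with `ϖ · Ω_E = Ω⁺_f` exactly as in the tree's transcription of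
Thm. 16 (`charIdeal_dvd_padicLFunction`).

Only the SPLIT MULTIPLICATIVE clause is transcribed (`corollary19_splitMultiplicative`): the good
ordinary clause for surjective `ρ_{E,p}` is Kato's Thm. 17.4 (3) (tree `kato_divisibility`), the
reducible clauses are Thm. 16 (`charIdeal_dvd_padicLFunction`), and the NON-split multiplicative
clause needs the `ε(p) = 0` interpolation package with `α = -1` (constant term `(1 - α⁻¹)[0]⁺`, one
Euler factor), which the tree's `IsPAdicLFunctionOf` (constant term `(1 - α⁻¹)²[0]⁺`) does not
express — `TODO(general form)` below. Use (cell `b2b-bsdres`, REPORT-g4.md §3): with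
`g ∈ char_Λ X` and `ι(T · g) = ϖ · L` this is the input `hι` (with `e = 1`, `c = ϖ`) of
`Typed.padicValNat_card_shaPrimary_le_of_leadingTerm_shape`; the other class-level input there
(J. W. Jones, Duke Math. J. 59 (1989), the leading term of `char_Λ X` at a multiplicative prime) is
not yet held (acq-07893).

References: [Wuthrich2014] Cor. 19 (p. 398; proof p. 399), Thm. 16 and §5 (p. 397), Cor. 18
(p. 398), §1 (pp. 381–383); [Kato2004Asterisque] Thm. 17.4; [MazurTateTeitelbaum1986] §I.10,
§I.12–I.14; S. Kobayashi, Doc. Math. Extra Vol. Coates (2006) (the split multiplicative Coleman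
map, Wuthrich's [11]).
-/

set_option autoImplicit false

noncomputable section

open scoped Classical MatrixGroups ModularForm

open CongruenceSubgroup WeierstrassCurve Literature.NumberTheory.EllipticCurves
  Literature.NumberTheory.EllipticCurves.ModularForms

namespace Literature.NumberTheory.EllipticCurves.Wuthrich2014

/-- **Wuthrich 2014, Corollary 19 (split multiplicative clause): for a semi-stable `E/ℚ` and an
odd prime `p` of split multiplicative reduction, `I · char_Λ X(E)` divides `(L_p(E))` in `Λ`.** As
published (Doc. Math. 19 (2014), Cor. 19, p. 398): "If `E/ℚ` is a semi-stable elliptic curve and `p`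
an odd prime where `E` has ordinary reduction, then `char_Λ(X(E))`, or `I char_Λ(X(E))` in the
split multiplicative case, divides the ideal generated by `L_p(E)`." (A multiplicative prime is
ordinary in the paper's sense, p. 383. Proof, p. 399: image `GL₂(𝔽_p)` or Borel by Serre; Borel =
Thm. 16; surjective = Kato's theorem, §1 p. 383; `p = 3` via Lemma 20; "the hypothesis … that `E`
is semi-stable can not be dropped".) Transcription of the split multiplicative clause ONLY, in the
vocabulary of `charIdeal_dvd_padicLFunction` (Thm. 16) and `PAdicBSD`: `W` a globally minimal model of a
semi-stable `E/ℚ` (`W.IsSemistable ℤ`), `p ≠ 2` a prime of split multiplicative reduction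
(`HasSplitMultiplicativeReductionAtPrime`), `ℚ_∞/ℚ` the cyclotomic `ℤ_p`-extension `κ` with
topological generator `γ` matching the cyclotomic variable (so `I = (T)`, `T = γ - 1`), `f` the
newform of `E`, `D` a Pontryagin-dual datum of the Selmer group over `ℚ_∞` (`char_Λ X = D.charIdeal`),
`ϖ ∈ ℚ` with `ϖ · Ω_E = Ω⁺_f`, and `L` THE `Ω⁺_f`-normalised `p`-adic `L`-function at the split
prime (`IsSplitMultPAdicLFunctionOf f p L`, MTT §I.10 with `α = a_p = 1`; unique by boundedness).
Conclusion: `ϖ · L ∈ ι(I · char_Λ X)`, i.e. `ι(T · g) = ϖ · L` for some `g ∈ char_Λ X`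
(`ι = iwasawaToPowerSeries p`). Nothing asserted (named fact).
-- TODO(general form): Cor. 19 also covers good ordinary `p` (surjective `ρ_{E,p}`: Kato Thm. 17.4
-- (3), tree `kato_divisibility`) and NON-split multiplicative `p` (`char_Λ X(E) ∣ (L_p(E))` with the
-- one-Euler-factor interpolation package, not yet expressible in the tree).
[cite: Wuthrich2014, Cor. 19 (p. 398), Thm. 16 and §5 (p. 397), Cor. 18 (p. 398)] -/
def corollary19_splitMultiplicative : Prop :=
  ∀ (W : WeierstrassCurve ℚ) [W.IsElliptic] [W.IsGloballyMinimal] (p : ℕ) [Fact p.Prime]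
    {κ : ZpExtension ℚ p} {γ : Field.absoluteGaloisGroup ℚ} {N : ℕ} [NeZero N]
    {f : CuspForm (Gamma0 N) 2},
    p ≠ 2 → W.IsSemistable ℤ → W.HasSplitMultiplicativeReductionAtPrime p →
    κ.IsCyclotomic → κ.IsTopGenerator γ → IsCyclotomicVariable p γ → IsNewformOf W f →
    ∀ (D : W.SelmerDualData κ γ) (ϖ : ℚ), (ϖ : ℝ) * W.realPeriodRat = plusPeriod f →
    ∀ (L : PowerSeries ℚ_[p]), IsSplitMultPAdicLFunctionOf f p L →
      ∃ g ∈ D.charIdeal, iwasawaToPowerSeries p (PowerSeries.X * g) =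
        PowerSeries.C ((ϖ : ℚ) : ℚ_[p]) * L

/-- **Bookkeeping: Cor. 19 (split clause) in the shape of the `p`-adic certificate engine.** Under
`corollary19_splitMultiplicative`, at a semi-stable curve and an odd split multiplicative prime the
divisibility input `hι` of `Typed.padicValNat_card_shaPrimary_le_of_leadingTerm_shape` holds with
`e = 1` and `c = ϖ`: `ϖ · L = T¹ · ι(g)` for some `g ∈ char_Λ X` (`ι` is a ring map with
`ι(T) = T`). [cite: Wuthrich2014, Cor. 19 (p. 398)] -/
theorem corollary19_splitMultiplicative.exists_engine_shape (h19 : corollary19_splitMultiplicative)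
    (W : WeierstrassCurve ℚ) [W.IsElliptic] [W.IsGloballyMinimal] (p : ℕ) [Fact p.Prime]
    {κ : ZpExtension ℚ p} {γ : Field.absoluteGaloisGroup ℚ} {N : ℕ} [NeZero N]
    {f : CuspForm (Gamma0 N) 2} (hp : p ≠ 2) (hss : W.IsSemistable ℤ)
    (hsplit : W.HasSplitMultiplicativeReductionAtPrime p) (hκ : κ.IsCyclotomic)
    (hγ : κ.IsTopGenerator γ) (hγ' : IsCyclotomicVariable p γ) (hf : IsNewformOf W f)
    (D : W.SelmerDualData κ γ) (ϖ : ℚ) (hϖ : (ϖ : ℝ) * W.realPeriodRat = plusPeriod f)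
    (L : PowerSeries ℚ_[p]) (hL : IsSplitMultPAdicLFunctionOf f p L) :
    ∃ g ∈ D.charIdeal, PowerSeries.C ((ϖ : ℚ) : ℚ_[p]) * L =
      PowerSeries.X ^ 1 * iwasawaToPowerSeries p g := by
  obtain ⟨g, hg, hιg⟩ := h19 W p hp hss hsplit hκ hγ hγ' hf D ϖ hϖ L hL
  refine ⟨g, hg, ?_⟩
  rw [← hιg, map_mul, pow_one]
  simp [iwasawaToPowerSeries, PowerSeries.map_X]

end Literature.NumberTheory.EllipticCurves.Wuthrich2014

end
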